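import Summits.HodgeConjecture.HodgeConjecture.Theorems.Ring2AtlasTypeIIRows
import Literature.AlgebraicGeometry.HodgeTheory.TotallyRealMaxSubfieldPowersHodgeClasses
import HarnessLib

/-!
# Ring 2 · atlas-2 (generation 90) — the atlas row `g6.II(3)` and the whole half-rank-one Murty class FACT-FREE in the kernel (V. K. Murty 1988 Thm. 2, case `m = 1`, now a tree theorem), and the open cell `HodgeQuaternionSixfold` cut down UNCONDITIONALLY to its members without a half-rank-one packet

HONEST FRAMING: research route conditional on HC_CM; not a corollary; Q11.4-sentence-2 already refuted in dim ≥ 3.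

Cell `pub-hodge-ring2`, seat `pub-hodge-ring2-atlas-2` (generation 90). `HC_CM` (`Theses.RankFourFaces.CMAbelianHodge`,
stmt-HodgeConjecture-3052) is NOT used anywhere in this file: KIND of `HC_CM` = ABSENT. No named fact is used either:
every theorem below is UNCONDITIONAL (axioms `propext`, `Classical.choice`, `Quot.sound`).

WHAT CHANGED IN THE TREE (2026-08-22, Literature lane of the cell, programme R6, p326229, commit 5bf50153ed70): the
Literature file `HodgeTheory/TotallyRealMaxSubfieldPowersHodgeClasses` PROVES V. K. Murty 1988 Thm. 2 in the case
`m = 1` — `hodgeConjectureFor_powSucc_of_isMurtyTypeWith_one : IsMurtyTypeWith A K φ 1 → ∀ N, HC(A^{N+1})` — i.e. the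
statement of `hodgeConjectureFor_powSucc_of_isMurtyTypeWith` (file `MurtyTotallyRealMaximalSubfieldHodgeClasses` §4)
at `m = 1` WITHOUT the fact binder `Murty1988_hodgeClasses_divisorial_powers_totallyRealMaxSubfield_oddHalfRank`.
The generation-18 module `Ring2AtlasTypeIIRows` bound the atlas rows `g6.II(1)` (`m = 3`) and `g6.II(3)` (`m = 1`) to
that named fact. THIS FILE re-derives, fact-free, exactly the `m = 1` part:
* §1 the CLASS TARGET `HCOnClass` on "abelian varieties carrying a Murty packet `(K, φ, 1)`" — `K ⊂ End⁰(A)` a totally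
  real self-commutant subfield with `[K:ℚ] = dim A` — and on its isogeny-closed POWER class, in the kernel's class-target
  currency (`Ring2.ClassTargets.HCOnClass`), unconditionally (`hcOnClass_isMurtyTypeWithOne`,
  `hcOnClass_isogenousPowSucc_isMurtyTypeWithOne`, the FACTOR form);
* §2 the ATLAS ROW `g6.II(3)` (a complex abelian SIXFOLD whose endomorphism algebra contains a self-commutant TOTALLY REAL
  SEXTIC field — in particular every simple sixfold of type II(3), by the MEMBERSHIP prose of `Ring2AtlasTypeIIRows`,
  and those of type I(6)): ALL POWERS have the Hodge property, NO fact binder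
  (`hodgeConjectureFor_powSucc_sixfold_totallyRealSexticMaxSubfield`); and the general half-rank-one row
  `[K:ℚ] = dim A` in every dimension (`hodgeConjectureFor_powSucc_of_totallyReal_selfCommutant_finrank_eq_dim`) —
  type II(g/2) in even dimension `g` (abelian surfaces with quaternionic multiplication and all their powers, …);
* §3 THE OPEN CELL CUT DOWN, UNCONDITIONALLY (kernel statement): the atlas-2 open cell `Ring2.Atlas.HodgeQuaternionSixfold`
  (simple sixfolds, `End⁰` non-commutative, no type-IV factor: types II(1), II(3), III(1)) is EQUIVALENT — with NO fact
  and NO hypothesis — to its sub-cell "… and NO Murty packet with `m = 1`"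
  (`hodgeQuaternionSixfold_iff_noMurtyPacketOne`, by the kernel's subdivision rule `hcOnClass_iff_and_split`). By the
  MEMBERSHIP prose of `Ring2AtlasTypeIIRows` (quaternion arithmetic, Vignéras III Thm. 3.8; not a tree theorem) the
  type II(3) members carry such a packet, so the residual sub-cell consists of the type II(1) members (`m = 3`: still
  "modulo Murty's Thm. 2" in the kernel, `Ring2AtlasTypeIIRows` §2/§4) and the type III(1) members (Murty 1984's
  exceptional classes, ENGINE B `b₃ - d₃ = 7`: the open content). Generation 18's statement
  `hodgeQuaternionSixfold_iff_noTotallyRealOddMaxSubfield_of_murty1988` (residual = type III(1), modulo the fact for all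
  odd `m`) is unchanged and still the sharper cut modulo the fact; this file's cut is the sharper UNCONDITIONAL one.
* §4 ON PATH: every class target here is a case of `HC_AV` (`Theses.PadicSemiregularLift.HodgeAbelianVarieties`,
  stmt-HodgeConjecture-1333, by name) and of the summit — bookkeeping, nothing here is summit progress.

PRINT STATUS of the rows: unchanged — KNOWN, refereed (Murty 1988 Thm. 2 [corpus:paper:doi-10-1090-s0002-9939-1988-0958044-1
p0007 L5–8]; case `m = 1` "a special case of [Hazama, Thm. 4.1]", p. 66; Moonen–Zarhin 1999 (1.8)). TREE STATUS after
this file: row `g6.II(3)` and the half-rank-one class = UNCONDITIONAL kernel theorems (before: kernel rows modulo ONE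
named print fact); row `g6.II(1)` (`m = 3`) = kernel row modulo the named fact, as before.

References: [Murty1988] Thm. 2 (p. 67), p. 66, §1 Remark 1; [Hazama1983] Thm. (1.1), §3; [MoonenZarhin1999LowDim]
(1.8), (2.2); [vanGeemen1994HodgeAV] Lemma 3.7; [Murty1984] Thm. (type III); [VignerasLNM800] III Thm. 3.8;
[Deligne2000] §1.
-/

set_option linter.dupNamespace false

noncomputable section

namespace Summit.HodgeConjecture.HodgeConjecture.Ring2.Atlas

open CategoryTheory
open Literature.AlgebraicGeometry Literature.AlgebraicGeometry.Motives
open Literature.AlgebraicGeometry.HodgeTheory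
open Summit.HodgeConjecture.HodgeConjecture.Theses
open Summit.HodgeConjecture.HodgeConjecture.Ring2.ClassTargets

variable {K : Type} [Field K] [NumberField K]

/-! ## §1 The half-rank-one Murty class, fact-free -/

/-- **CLASS TARGET, UNCONDITIONAL: the Hodge conjecture on the class of complex abelian varieties carrying a Murty
packet `(K, φ, 1)`** — `K` a totally real number field, `φ : K →+* End⁰(A)` its own commutant, `dim A = [K:ℚ]`
(`A` itself, `N = 0`). Murty 1988 Thm. 2, case `m = 1`, a tree theorem (`hodgeConjectureFor_self_of_isMurtyTypeWith_one`).
KIND of `HC_CM`: ABSENT; no fact. [cite: Murty1988, Thm. 2 and §1 Remark 1] [cite: Hazama1983, Thm. (1.1) and §3]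
[cite: Deligne2000, §1] -/
theorem hcOnClass_isMurtyTypeWithOne :
    HCOnClass fun A ↦ ∃ (K : Type) (_ : Field K) (_ : NumberField K) (φ : K →+* A.endAlgebra),
      IsMurtyTypeWith A K φ 1 := by
  rintro A ⟨K, _, _, φ, hA⟩
  exact hodgeConjectureFor_self_of_isMurtyTypeWith_one hA

/-- **CLASS TARGET, UNCONDITIONAL: the isogeny-closed POWER class** — `X` isogenous to some power `A^{N+1}` of an
abelian variety carrying a Murty packet `(K, φ, 1)`: powers by the Literature theorem, the isogeny by van Geemen's
Lemma 3.7 (`HodgeConjectureFor.of_isIsogenous`, a tree theorem). KIND of `HC_CM`: ABSENT; no fact.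
[cite: Murty1988, Thm. 2 (p. 67)] [cite: vanGeemen1994HodgeAV, Lemma 3.7] [cite: Deligne2000, §1] -/
theorem hcOnClass_isogenousPowSucc_isMurtyTypeWithOne :
    HCOnClass fun X ↦ ∃ (A : AbelianVariety ℂ) (K : Type) (_ : Field K) (_ : NumberField K)
      (φ : K →+* A.endAlgebra) (N : ℕ), IsMurtyTypeWith A K φ 1 ∧ AbelianVariety.IsIsogenous X (A.powSucc N) := by
  rintro X ⟨A, K, _, _, φ, N, hA, hX⟩
  exact hodgeConjectureFor_of_isIsogenous_powSucc_of_isMurtyTypeWith_one hA hX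

/-- **FACTOR form, UNCONDITIONAL**: if `X × Y` is isogenous to a power `A^{N+1}` of an abelian variety carrying a
Murty packet `(K, φ, 1)`, then HC(`X`) (restriction to the slice `X × {0}`, `hodgeConjectureFor_left_of_prod`).
[cite: Murty1988, Thm. 2 (p. 67)] [cite: vanGeemen1994HodgeAV, Lemma 3.7] -/
theorem hodgeConjectureFor_of_prod_isIsogenous_powSucc_of_isMurtyTypeWithOne (X Y : AbelianVariety ℂ)
    {A : AbelianVariety ℂ} {φ : K →+* A.endAlgebra} (hA : IsMurtyTypeWith A K φ 1) (N : ℕ)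
    (hXY : AbelianVariety.IsIsogenous (X.prod Y) (A.powSucc N)) : HodgeConjectureFor X.dim X.X :=
  hodgeConjectureFor_left_of_prod X Y
    (hcOnClass_isogenousPowSucc_isMurtyTypeWithOne (X.prod Y) ⟨A, K, inferInstance, inferInstance, φ, N, hA, hXY⟩)

/-- The fact-free class sits inside generation 18's class `HasTotallyRealOddMaxSubfield` (all odd `m`).
[cite: Murty1988, Thm. 2] -/
theorem hasTotallyRealOddMaxSubfield_of_exists_isMurtyTypeWithOne {A : AbelianVariety ℂ}
    (hA : ∃ (K : Type) (_ : Field K) (_ : NumberField K) (φ : K →+* A.endAlgebra), IsMurtyTypeWith A K φ 1) :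
    HasTotallyRealOddMaxSubfield A := by
  obtain ⟨K, _, _, φ, hA⟩ := hA
  exact hasTotallyRealOddMaxSubfield_of_isMurtyTypeWith hA

/-! ## §2 The atlas row `g6.II(3)` and the half-rank-one row in every dimension, fact-free -/

/-- **ATLAS ROW `g6.II(3)`, UNCONDITIONAL: a complex abelian sixfold whose endomorphism algebra contains a
self-commutant TOTALLY REAL SEXTIC field — in particular every simple sixfold of type II(3) — ALL POWERS `A^{N+1}`
have the Hodge property.** The statement of generation 18's
`hodgeConjectureFor_powSucc_sixfold_totallyRealSexticMaxSubfield_of_murty1988` WITHOUT its fact binder.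
KIND of `HC_CM`: ABSENT; no fact. [cite: Murty1988, Thm. 2 (p. 67) and p. 66] [cite: MoonenZarhin1999LowDim, (1.8)]
[cite: Hazama1983, Thm. (1.1)] -/
theorem hodgeConjectureFor_powSucc_sixfold_totallyRealSexticMaxSubfield
    (A : AbelianVariety ℂ) (hA : A.dim = 6) (hK : NumberField.IsTotallyReal K) (h6 : Module.finrank ℚ K = 6)
    (φ : K →+* A.endAlgebra) (hφ : ∀ x : A.endAlgebra, (∀ y : K, Commute x (φ y)) → x ∈ Set.range φ) (N : ℕ) :
    HodgeConjectureFor (A.powSucc N).dim (A.powSucc N).X :=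
  hodgeConjectureFor_powSucc_of_isMurtyTypeWith_one (isMurtyTypeWith_sixfold_totallyRealSextic hA hK h6 hφ) N

/-- **Row `g6.II(3)`, the sixfold itself (`N = 0`), UNCONDITIONAL.** [cite: Murty1988, Thm. 2 (p. 67)] -/
theorem hodgeConjectureFor_sixfold_totallyRealSexticMaxSubfield
    (A : AbelianVariety ℂ) (hA : A.dim = 6) (hK : NumberField.IsTotallyReal K) (h6 : Module.finrank ℚ K = 6)
    (φ : K →+* A.endAlgebra) (hφ : ∀ x : A.endAlgebra, (∀ y : K, Commute x (φ y)) → x ∈ Set.range φ) :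
    HodgeConjectureFor A.dim A.X :=
  hodgeConjectureFor_self_of_isMurtyTypeWith_one (isMurtyTypeWith_sixfold_totallyRealSextic hA hK h6 hφ)

/-- **The half-rank-one row in EVERY dimension, UNCONDITIONAL: `K ⊂ End⁰(A)` totally real, self-commutant,
`[K:ℚ] = dim A` ⟹ all powers `A^{N+1}` have the Hodge property** (type II(g/2) in even dimension `g` — e.g.
abelian surfaces with quaternionic multiplication, the type-II fourfolds over a real quadratic field, the type-II
sixfolds over a totally real cubic field —, and `End⁰(A)` a totally real field of degree `dim A`).
[cite: Murty1988, Thm. 2 (case `m = 1`) and p. 66] [cite: Hazama1983, Thm. (1.1)] -/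
theorem hodgeConjectureFor_powSucc_of_totallyReal_selfCommutant_finrank_eq_dim
    (A : AbelianVariety ℂ) (hK : NumberField.IsTotallyReal K) (he : Module.finrank ℚ K = A.dim)
    (φ : K →+* A.endAlgebra) (hφ : ∀ x : A.endAlgebra, (∀ y : K, Commute x (φ y)) → x ∈ Set.range φ) (N : ℕ) :
    HodgeConjectureFor (A.powSucc N).dim (A.powSucc N).X :=
  hodgeConjectureFor_powSucc_of_isMurtyTypeWith_one (isMurtyTypeWith_of_finrank_eq_dim hK he hφ) N

/-! ## §3 The open cell `HodgeQuaternionSixfold` cut down UNCONDITIONALLY -/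

/-- **The members of the open cell carrying a Murty packet `(K, φ, 1)` are closed in the kernel, UNCONDITIONALLY**
(by the MEMBERSHIP prose of `Ring2AtlasTypeIIRows`: the type II(3) members). [cite: Murty1988, Thm. 2 (p. 67)]
[cite: VignerasLNM800, III Thm. 3.8] -/
theorem hcOnClass_quaternionSixfold_murtyPacketOne :
    HCOnClass fun A ↦ (A.dim = 6 ∧ A.IsSimple ∧ (∃ ψ χ : A ⟶ A, ψ ≫ χ ≠ χ ≫ ψ) ∧ HasNoTypeIVFactor A) ∧
      ∃ (K : Type) (_ : Field K) (_ : NumberField K) (φ : K →+* A.endAlgebra), IsMurtyTypeWith A K φ 1 :=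
  hcOnClass_mono (fun _ hA ↦ hA.2) hcOnClass_isMurtyTypeWithOne

/-- **KERNEL STATEMENT, UNCONDITIONAL: the open cell `HodgeQuaternionSixfold` is EQUIVALENT to its sub-cell of
members WITHOUT a Murty packet `(K, φ, 1)`** (the kernel's subdivision rule `hcOnClass_iff_and_split` along
"`∃` a half-rank-one packet", that half discharged by the tree theorem). By the MEMBERSHIP prose of
`Ring2AtlasTypeIIRows` (quaternion arithmetic, not a tree theorem) the residual sub-cell consists of the type II(1)
members (`m = 3`; kernel status: modulo Murty's Thm. 2, `Ring2AtlasTypeIIRows` §2) and the type III(1) members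
(Murty 1984's exceptional Hodge classes, ENGINE B `b₃ - d₃ = 7`; the open content named in the cell's docstring).
No fact, no hypothesis. [cite: Murty1988, Thm. 2 (p. 67)] [cite: Murty1984, Thm. (type III)]
[cite: VignerasLNM800, III Thm. 3.8] -/
theorem hodgeQuaternionSixfold_iff_noMurtyPacketOne :
    HodgeQuaternionSixfold ↔
      HCOnClass fun A ↦ (A.dim = 6 ∧ A.IsSimple ∧ (∃ ψ χ : A ⟶ A, ψ ≫ χ ≠ χ ≫ ψ) ∧ HasNoTypeIVFactor A) ∧
        ¬ ∃ (K : Type) (_ : Field K) (_ : NumberField K) (φ : K →+* A.endAlgebra), IsMurtyTypeWith A K φ 1 :=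
  (hcOnClass_iff_and_split fun A ↦
      ∃ (K : Type) (_ : Field K) (_ : NumberField K) (φ : K →+* A.endAlgebra), IsMurtyTypeWith A K φ 1).trans
    (and_iff_right hcOnClass_quaternionSixfold_murtyPacketOne)

/-- Unconditionally the open cell implies its residual sub-cell (the trivial direction, for the record). [folklore] -/
theorem hcOnClass_quaternionSixfold_noMurtyPacketOne_of_hodgeQuaternionSixfold (h : HodgeQuaternionSixfold) :
    HCOnClass fun A ↦ (A.dim = 6 ∧ A.IsSimple ∧ (∃ ψ χ : A ⟶ A, ψ ≫ χ ≠ χ ≫ ψ) ∧ HasNoTypeIVFactor A) ∧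
      ¬ ∃ (K : Type) (_ : Field K) (_ : NumberField K) (φ : K →+* A.endAlgebra), IsMurtyTypeWith A K φ 1 :=
  hodgeQuaternionSixfold_iff_noMurtyPacketOne.mp h

/-- **The two cuts compared**: generation 18's residual (no totally real ODD self-commutant subfield at all, modulo
the fact) lies inside this file's residual (no half-rank-ONE packet, unconditional) — `m = 1` is odd. [cite: Murty1988, Thm. 2] -/
theorem noMurtyPacketOne_of_noTotallyRealOddMaxSubfield {A : AbelianVariety ℂ} (h : ¬ HasTotallyRealOddMaxSubfield A) :
    ¬ ∃ (K : Type) (_ : Field K) (_ : NumberField K) (φ : K →+* A.endAlgebra), IsMurtyTypeWith A K φ 1 :=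
  fun hA ↦ h (hasTotallyRealOddMaxSubfield_of_exists_isMurtyTypeWithOne hA)

/-! ## §4 On path: every class target here is a case of `HC_AV` and of the summit -/

/-- ON-PATH: the half-rank-one Murty class is a case of `HC_AV` (stmt-HodgeConjecture-1333 by name).
[cite: Deligne2000, §1] -/
theorem hcOnClass_isMurtyTypeWithOne_of_hodgeAbelianVarieties (h : PadicSemiregularLift.HodgeAbelianVarieties) :
    HCOnClass fun A ↦ ∃ (K : Type) (_ : Field K) (_ : NumberField K) (φ : K →+* A.endAlgebra),
      IsMurtyTypeWith A K φ 1 :=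
  hcOnClass_of_hodgeAbelianVarieties _ h

/-- ON-PATH: the isogeny-closed power class is a case of `HC_AV`. [cite: Deligne2000, §1] -/
theorem hcOnClass_isogenousPowSucc_isMurtyTypeWithOne_of_hodgeAbelianVarieties
    (h : PadicSemiregularLift.HodgeAbelianVarieties) :
    HCOnClass fun X ↦ ∃ (A : AbelianVariety ℂ) (K : Type) (_ : Field K) (_ : NumberField K)
      (φ : K →+* A.endAlgebra) (N : ℕ), IsMurtyTypeWith A K φ 1 ∧ AbelianVariety.IsIsogenous X (A.powSucc N) :=
  hcOnClass_of_hodgeAbelianVarieties _ h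

/-- ON-PATH: … and of the summit. [cite: Deligne2000, §1] -/
theorem hcOnClass_isMurtyTypeWithOne_of_hodgeConjecture (h : _root_.HodgeConjecture) :
    HCOnClass fun A ↦ ∃ (K : Type) (_ : Field K) (_ : NumberField K) (φ : K →+* A.endAlgebra),
      IsMurtyTypeWith A K φ 1 :=
  hcOnClass_of_hodgeConjecture _ h

/-- ON-PATH: the residual sub-cell of §3 is a case of `HC_AV`. [cite: Deligne2000, §1] -/
theorem hcOnClass_quaternionSixfold_noMurtyPacketOne_of_hodgeAbelianVarieties
    (h : PadicSemiregularLift.HodgeAbelianVarieties) :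
    HCOnClass fun A ↦ (A.dim = 6 ∧ A.IsSimple ∧ (∃ ψ χ : A ⟶ A, ψ ≫ χ ≠ χ ≫ ψ) ∧ HasNoTypeIVFactor A) ∧
      ¬ ∃ (K : Type) (_ : Field K) (_ : NumberField K) (φ : K →+* A.endAlgebra), IsMurtyTypeWith A K φ 1 :=
  hcOnClass_of_hodgeAbelianVarieties _ h

end Summit.HodgeConjecture.HodgeConjecture.Ring2.Atlas

end
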